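import Summits.Ventures.QEC.Census.RefinedIPCertificate
import HarnessLib

/-!
# Refined certificates: box sums, split rows, and the row identities used by the leaf check (lemmas)

Venture QEC (cell `qec`, rung X1; row 06). Second of three files implementing certificates for CRSS's linear program
refined with respect to a codeword [CalderbankEtAl1998, §7 (ii)] (`RefinedIPCertificate.lean`: certificates and the
pure checker; THIS file: the algebra of the box sums `Σ_{a ≤ n−w₀, b ≤ w₀, c ≤ w₀}` and, for each row family of the
refined system `CRSSRefinedSystem` (marginals, the MacWilliams identity at evaluation points, translation symmetry),
the identity «multiplier × (row) regrouped by unknown» that weak duality needs; `RefinedIPCertificateSound.lean`: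
weak duality, soundness of the tree checker, and the assembly of CRSS's two-stage argument). HONEST FRAMING: lemmas
about finite sums; nothing here certifies a distance. [cite: CalderbankEtAl1998, §7 (ii) (printed p. 28)];
[cite: MacWilliamsSloane1977, Ch. 17 §4 Thm. 20] (dual vectors as certificates).
-/

namespace Summit.Ventures.QEC.Census

open Finset Literature.InformationTheory.QuantumCodes


/-! ### 4. Soundness -/

section Soundness

variable {n k d e w₀ : ℕ} {A B W : ℕ → ℕ} {R Rp : ℕ → ℕ → ℕ → ℕ}

/-- The box of refined classes `a ≤ n − w₀`, `b ≤ w₀`, `c ≤ w₀` as a sum operator. [folklore] -/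
def boxSum (n w₀ : ℕ) (f : ℕ → ℕ → ℕ → ℤ) : ℤ :=
  ∑ a ∈ range (n - w₀ + 1), ∑ b ∈ range (w₀ + 1), ∑ c ∈ range (w₀ + 1), f a b c

/-- `boxSum` is additive. [folklore] -/
theorem boxSum_add (n w₀ : ℕ) (f g : ℕ → ℕ → ℕ → ℤ) :
    boxSum n w₀ (fun a b c => f a b c + g a b c) = boxSum n w₀ f + boxSum n w₀ g := by
  simp only [boxSum, Finset.sum_add_distrib]

/-- `boxSum` is linear in integer scalars. [folklore] -/
theorem boxSum_mul (n w₀ : ℕ) (y : ℤ) (f : ℕ → ℕ → ℕ → ℤ) :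
    boxSum n w₀ (fun a b c => y * f a b c) = y * boxSum n w₀ f := by
  simp only [boxSum, Finset.mul_sum]

/-- `boxSum` commutes with finite sums. [folklore] -/
theorem boxSum_finset_sum (n w₀ : ℕ) (s : Finset ℕ) (f : ℕ → ℕ → ℕ → ℕ → ℤ) :
    boxSum n w₀ (fun a b c => ∑ j ∈ s, f j a b c) = ∑ j ∈ s, boxSum n w₀ (f j) := by
  classical
  induction s using Finset.induction_on with
  | empty => simp [boxSum]
  | insert j s hj ih =>
    simp only [Finset.sum_insert hj, ← ih, ← boxSum_add]

/-- A box sum against the indicator of one point `(0, b₀, 0)` of the box. [folklore] -/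
theorem boxSum_ite_eq (n w₀ b₀ : ℕ) (hb₀ : b₀ ≤ w₀) (y : ℤ) (g : ℕ → ℕ → ℕ → ℤ) :
    boxSum n w₀ (fun a b c => (if a = 0 ∧ b = b₀ ∧ c = 0 then y else 0) * g a b c) = y * g 0 b₀ 0 := by
  unfold boxSum
  rw [Finset.sum_eq_single_of_mem 0 (mem_range.2 (by omega))]
  · rw [Finset.sum_eq_single_of_mem b₀ (mem_range.2 (by omega))]
    · rw [Finset.sum_eq_single_of_mem 0 (mem_range.2 (by omega))]
      · simp
      · intro c _ hc; simp [hc]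
    · intro b _ hb; exact Finset.sum_eq_zero fun c _ => by simp [hb]
  · intro a _ ha; exact Finset.sum_eq_zero fun b _ => Finset.sum_eq_zero fun c _ => by simp [ha]

/-- `boxSum` of a pointwise-nonpositive family is `≤ 0`. [folklore] -/
theorem boxSum_nonpos {n w₀ : ℕ} {f : ℕ → ℕ → ℕ → ℤ}
    (h : ∀ a ∈ range (n - w₀ + 1), ∀ b ∈ range (w₀ + 1), ∀ c ∈ range (w₀ + 1), f a b c ≤ 0) : boxSum n w₀ f ≤ 0 :=
  Finset.sum_nonpos fun a ha => Finset.sum_nonpos fun b hb => Finset.sum_nonpos fun c hc => h a ha b hb c hc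

/-- The value of a split form at `(A,B,W,R,R')`. [folklore] -/
def RSplit.form (n w₀ : ℕ) (s : RSplit) (A B W : ℕ → ℕ) (R Rp : ℕ → ℕ → ℕ → ℕ) : ℤ :=
  ∑ j ∈ range (n + 1), (s.ca.getD j 0 * A j + s.cb.getD j 0 * B j + s.cw.getD j 0 * W j) +
    boxSum n w₀ fun a b c => get3 s.cr a b c * R a b c + get3 s.crp a b c * Rp a b c

/-- A split on the path HOLDS: `sgn · form ≥ rhs` (`form ≤ v` resp. `form ≥ v + 1`). [folklore] -/
def RSplit.Holds (n w₀ : ℕ) (s : RSplit) (A B W : ℕ → ℕ) (R Rp : ℕ → ℕ → ℕ → ℕ) : Prop :=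
  s.rhs ≤ s.sgn * s.form n w₀ A B W R Rp

/-- The split multipliers pair the path into `Σ_i s_i (sgn_i form_i − rhs_i) ≥ 0`, regrouped by unknown.
[cite: MacWilliamsSloane1977, Ch. 17 §4 Thm. 20] -/
theorem splitRhs_le (path : List RSplit) (ys : List ℤ) (hs : splitSignsOK path ys = true)
    (hp : ∀ s ∈ path, s.Holds n w₀ A B W R Rp) :
    splitRhs path ys ≤
      ∑ j ∈ range (n + 1), (splitCoef path ys (fun s => s.ca.getD j 0) * A j +
        splitCoef path ys (fun s => s.cb.getD j 0) * B j + splitCoef path ys (fun s => s.cw.getD j 0) * W j) +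
      boxSum n w₀ fun a b c =>
        splitCoef path ys (fun s => get3 s.cr a b c) * R a b c + splitCoef path ys (fun s => get3 s.crp a b c) * Rp a b c := by
  induction path generalizing ys with
  | nil =>
    cases ys with
    | nil => simp [splitRhs, splitCoef, boxSum]
    | cons _ _ => simp [splitSignsOK] at hs
  | cons sp sps ih =>
    cases ys with
    | nil => simp [splitSignsOK] at hs
    | cons y ys =>
      simp only [splitSignsOK, Bool.and_eq_true, decide_eq_true_eq] at hs
      have h1 : y * sp.rhs ≤ y * (sp.sgn * sp.form n w₀ A B W R Rp) :=
        mul_le_mul_of_nonneg_left (hp sp (by simp)) hs.1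
      have h2 := ih ys hs.2 (fun s hs' => hp s (List.mem_cons_of_mem _ hs'))
      simp only [splitRhs, splitCoef]
      have hexp : y * (sp.sgn * sp.form n w₀ A B W R Rp) +
          (∑ j ∈ range (n + 1), (splitCoef sps ys (fun s => s.ca.getD j 0) * A j +
            splitCoef sps ys (fun s => s.cb.getD j 0) * B j + splitCoef sps ys (fun s => s.cw.getD j 0) * W j) +
          boxSum n w₀ fun a b c =>
            splitCoef sps ys (fun s => get3 s.cr a b c) * R a b c + splitCoef sps ys (fun s => get3 s.crp a b c) * Rp a b c) =
          ∑ j ∈ range (n + 1), ((y * sp.sgn * sp.ca.getD j 0 + splitCoef sps ys fun s => s.ca.getD j 0) * A j +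
            (y * sp.sgn * sp.cb.getD j 0 + splitCoef sps ys fun s => s.cb.getD j 0) * B j +
            (y * sp.sgn * sp.cw.getD j 0 + splitCoef sps ys fun s => s.cw.getD j 0) * W j) +
          boxSum n w₀ fun a b c =>
            (y * sp.sgn * get3 sp.cr a b c + splitCoef sps ys fun s => get3 s.cr a b c) * R a b c +
            (y * sp.sgn * get3 sp.crp a b c + splitCoef sps ys fun s => get3 s.crp a b c) * Rp a b c := by
        simp only [RSplit.form, boxSum]
        have e1 : ∀ j, y * (sp.sgn * (sp.ca.getD j 0 * (A j : ℤ) + sp.cb.getD j 0 * B j + sp.cw.getD j 0 * W j)) +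
            (splitCoef sps ys (fun s => s.ca.getD j 0) * A j + splitCoef sps ys (fun s => s.cb.getD j 0) * B j +
              splitCoef sps ys (fun s => s.cw.getD j 0) * W j) =
            (y * sp.sgn * sp.ca.getD j 0 + splitCoef sps ys fun s => s.ca.getD j 0) * A j +
              (y * sp.sgn * sp.cb.getD j 0 + splitCoef sps ys fun s => s.cb.getD j 0) * B j +
              (y * sp.sgn * sp.cw.getD j 0 + splitCoef sps ys fun s => s.cw.getD j 0) * W j := fun j => by ring
        have e2 : ∀ a b c, y * (sp.sgn * (get3 sp.cr a b c * (R a b c : ℤ) + get3 sp.crp a b c * Rp a b c)) +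
            (splitCoef sps ys (fun s => get3 s.cr a b c) * R a b c + splitCoef sps ys (fun s => get3 s.crp a b c) * Rp a b c) =
            (y * sp.sgn * get3 sp.cr a b c + splitCoef sps ys fun s => get3 s.cr a b c) * R a b c +
              (y * sp.sgn * get3 sp.crp a b c + splitCoef sps ys fun s => get3 s.crp a b c) * Rp a b c :=
          fun a b c => by ring
        rw [← Finset.sum_congr rfl fun j _ => e1 j]
        simp only [← e2, Finset.sum_add_distrib, Finset.mul_sum, mul_add]
        ring
      linarith [hexp]

/-- All clauses used by the leaf, bundled: the plain system, the refined system, and the path.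
[cite: CalderbankEtAl1998, §7 (ii)] -/
structure LeafHyp (n k d e w₀ : ℕ) (path : List RSplit) (A B W : ℕ → ℕ) (R Rp : ℕ → ℕ → ℕ → ℕ) : Prop where
  /-- the plain integer system -/
  sys : CRSSIntSystem n k d A B W e
  /-- the refined system -/
  ref : CRSSRefinedSystem n k d w₀ A B R Rp
  /-- the splits on the path hold -/
  path : ∀ s ∈ path, s.Holds n w₀ A B W R Rp

/-- Marginal rows, restricted to the triangle `b + c ≤ w₀` (the other entries vanish by the support clause).
[cite: CalderbankEtAl1998, §7 (ii)] -/
theorem margR_tri (href : CRSSRefinedSystem n k d w₀ A B R Rp) {j : ℕ} (hj : j ≤ n) :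
    boxSum n w₀ (fun a b c => if b + c ≤ w₀ ∧ a + b + c = j then (R a b c : ℤ) else 0) = A j := by
  obtain ⟨hmR, -, -, -, hsup, -⟩ := href
  have h := hmR j hj
  rw [← h]
  unfold boxSum
  push_cast
  refine Finset.sum_congr rfl fun a _ => Finset.sum_congr rfl fun b _ => Finset.sum_congr rfl fun c _ => ?_
  by_cases htri : b + c ≤ w₀
  · simp [htri]
  · have h0 : R a b c = 0 := (hsup a b c (Or.inr (by omega))).1
    simp [htri, h0]

/-- Marginal rows for `R'`, restricted to the triangle. [cite: CalderbankEtAl1998, §7 (ii)] -/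
theorem margRp_tri (href : CRSSRefinedSystem n k d w₀ A B R Rp) {j : ℕ} (hj : j ≤ n) :
    boxSum n w₀ (fun a b c => if b + c ≤ w₀ ∧ a + b + c = j then (Rp a b c : ℤ) else 0) = B j := by
  obtain ⟨-, hmRp, -, -, hsup, -⟩ := href
  have h := hmRp j hj
  rw [← h]
  unfold boxSum
  push_cast
  refine Finset.sum_congr rfl fun a _ => Finset.sum_congr rfl fun b _ => Finset.sum_congr rfl fun c _ => ?_
  by_cases htri : b + c ≤ w₀
  · simp [htri]
  · have h0 : Rp a b c = 0 := (hsup a b c (Or.inr (by omega))).2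
    simp [htri, h0]

/-- `refPoly` restricted to the triangle equals `refPoly` (support clause). [cite: CalderbankEtAl1998, §7 (ii)] -/
theorem refPoly_tri (hsup : ∀ a b c, (n - w₀ < a ∨ w₀ < b + c) → R a b c = 0 ∧ Rp a b c = 0)
    (p : ℤ × ℤ × ℤ × ℤ × ℤ) :
    boxSum n w₀ (fun a b c => if b + c ≤ w₀ then (R a b c : ℤ) * monoAt (n - w₀) w₀ p a b c else 0) =
      refPoly (n - w₀) w₀ R p.1 p.2.1 p.2.2.1 p.2.2.2.1 p.2.2.2.2 ∧
    boxSum n w₀ (fun a b c => if b + c ≤ w₀ then (Rp a b c : ℤ) * monoAt (n - w₀) w₀ p a b c else 0) =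
      refPoly (n - w₀) w₀ Rp p.1 p.2.1 p.2.2.1 p.2.2.2.1 p.2.2.2.2 := by
  constructor <;>
  · unfold boxSum refPoly monoAt
    refine Finset.sum_congr rfl fun a _ => Finset.sum_congr rfl fun b _ => Finset.sum_congr rfl fun c _ => ?_
    by_cases htri : b + c ≤ w₀
    · simp [htri]
    · have h0 := hsup a b c (Or.inr (by omega))
      simp [htri, h0.1, h0.2]

/-- The evaluation-point rows: `Σ_p μ_p (2^{n−k} R'(p) − R(T p)) = 0`, regrouped by unknown.
[cite: CalderbankEtAl1998, §7 (ii)] -/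
theorem pts_identity (href : CRSSRefinedSystem n k d w₀ A B R Rp) (pts : List ((ℤ × ℤ × ℤ × ℤ × ℤ) × ℤ)) :
    boxSum n w₀ (fun a b c =>
      (if b + c ≤ w₀ then (2 : ℤ) ^ (n - k) * (pts.map fun q => q.2 * monoAt (n - w₀) w₀ q.1 a b c).sum else 0) * Rp a b c +
      (if b + c ≤ w₀ then -(pts.map fun q => q.2 * monoAt (n - w₀) w₀ (tPt q.1) a b c).sum else 0) * R a b c) = 0 := by
  obtain ⟨-, -, hid, -, hsup, -⟩ := href
  induction pts with
  | nil =>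
    unfold boxSum
    simp
  | cons q qs ih =>
    have hq : (2 : ℤ) ^ (n - k) * refPoly (n - w₀) w₀ Rp q.1.1 q.1.2.1 q.1.2.2.1 q.1.2.2.2.1 q.1.2.2.2.2 =
        refPoly (n - w₀) w₀ R (tPt q.1).1 (tPt q.1).2.1 (tPt q.1).2.2.1 (tPt q.1).2.2.2.1 (tPt q.1).2.2.2.2 := by
      simp only [tPt]; exact hid _ _ _ _ _
    have hR := (refPoly_tri (R := R) (Rp := Rp) hsup (tPt q.1)).1
    have hRp := (refPoly_tri (R := R) (Rp := Rp) hsup q.1).2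
    -- split off the head point
    have hsplit : boxSum n w₀ (fun a b c =>
        (if b + c ≤ w₀ then (2 : ℤ) ^ (n - k) * ((q :: qs).map fun q' => q'.2 * monoAt (n - w₀) w₀ q'.1 a b c).sum
          else 0) * Rp a b c +
        (if b + c ≤ w₀ then -((q :: qs).map fun q' => q'.2 * monoAt (n - w₀) w₀ (tPt q'.1) a b c).sum else 0) * R a b c) =
        q.2 * ((2 : ℤ) ^ (n - k) *
          boxSum n w₀ (fun a b c => if b + c ≤ w₀ then (Rp a b c : ℤ) * monoAt (n - w₀) w₀ q.1 a b c else 0) -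
          boxSum n w₀ (fun a b c => if b + c ≤ w₀ then (R a b c : ℤ) * monoAt (n - w₀) w₀ (tPt q.1) a b c else 0)) +
        boxSum n w₀ (fun a b c =>
          (if b + c ≤ w₀ then (2 : ℤ) ^ (n - k) * (qs.map fun q' => q'.2 * monoAt (n - w₀) w₀ q'.1 a b c).sum else 0) *
              Rp a b c +
            (if b + c ≤ w₀ then -(qs.map fun q' => q'.2 * monoAt (n - w₀) w₀ (tPt q'.1) a b c).sum else 0) * R a b c) := by
      rw [mul_sub, ← mul_assoc, ← boxSum_mul, ← boxSum_mul]
      unfold boxSum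
      rw [← Finset.sum_sub_distrib, ← Finset.sum_add_distrib]
      refine Finset.sum_congr rfl fun a _ => ?_
      rw [← Finset.sum_sub_distrib, ← Finset.sum_add_distrib]
      refine Finset.sum_congr rfl fun b _ => ?_
      rw [← Finset.sum_sub_distrib, ← Finset.sum_add_distrib]
      refine Finset.sum_congr rfl fun c _ => ?_
      beta_reduce
      simp only [List.map_cons, List.sum_cons]
      split_ifs <;> ring
    rw [hsplit, hRp, hR, hq, sub_self, mul_zero, zero_add, ih]

/-- The involution `(a,b,c) ↦ (a, w₀−b−c, c)` on the triangle: reindexing a triangle sum.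
[cite: CalderbankEtAl1998, §7 (ii) («(a(u+u₀), b(u+u₀), c(u+u₀)) = (a(u), 12−b(u)−c(u), c(u))»)] -/
theorem boxSum_translate (n w₀ : ℕ) (f g : ℕ → ℕ → ℕ → ℤ) :
    boxSum n w₀ (fun a b c => if b + c ≤ w₀ then f a b c * g a (w₀ - b - c) c else 0) =
      boxSum n w₀ (fun a b c => if b + c ≤ w₀ then f a (w₀ - b - c) c * g a b c else 0) := by
  unfold boxSum
  refine Finset.sum_congr rfl fun a _ => ?_
  rw [Finset.sum_comm, Finset.sum_comm (f := fun b c => if b + c ≤ w₀ then f a (w₀ - b - c) c * g a b c else 0)]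
  refine Finset.sum_congr rfl fun c hc => ?_
  have hcw : c ≤ w₀ := Nat.lt_succ_iff.1 (mem_range.1 hc)
  -- both sides are sums over `b ≤ w₀ − c`; reflect `b ↦ (w₀ − c) − b`
  have hcut : ∀ h : ℕ → ℤ, ∑ b ∈ range (w₀ + 1), (if b + c ≤ w₀ then h b else 0) =
      ∑ b ∈ range (w₀ - c + 1), h b := by
    intro h
    rw [Finset.sum_ite, Finset.sum_const_zero, add_zero]
    refine Finset.sum_congr ?_ (fun _ _ => rfl)
    ext b; simp only [mem_filter, mem_range]; omega
  rw [hcut (fun b => f a b c * g a (w₀ - b - c) c), hcut (fun b => f a (w₀ - b - c) c * g a b c),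
    ← Finset.sum_range_reflect]
  refine Finset.sum_congr rfl fun b hb => ?_
  have hb' := mem_range.1 hb
  have e1 : w₀ - (w₀ - c + 1 - 1 - b) - c = b := by omega
  have e2 : w₀ - c + 1 - 1 - b = w₀ - b - c := by omega
  rw [e1, e2]

end Soundness

/-! ### Data helpers: the canonical evaluation grid -/

/-- The canonical evaluation points `(1, i − ⌊m/2⌋, 1, j, l)`, `i ≤ m`, `j + l ≤ w₀` (a unisolvent set for the refined
monomials `x₁^{a} y₁^{b} y₂^{c}`, `a ≤ m`, `b + c ≤ w₀`), in a fixed order; certificates list multipliers in this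
order. Column: definition (ours). [folklore] -/
def gridPts (m w₀ : ℕ) : List (ℤ × ℤ × ℤ × ℤ × ℤ) :=
  (List.range (m + 1)).flatMap fun i => (List.range (w₀ + 1)).flatMap fun j => (List.range (w₀ + 1 - j)).map fun l =>
    ((1 : ℤ), (i : ℤ) - ((m / 2 : ℕ) : ℤ), (1 : ℤ), (j : ℤ), (l : ℤ))

/-- The evaluation points of a leaf from a multiplier list in grid order (zero multipliers dropped).
Column: definition (ours). [folklore] -/
def gridLeafPts (m w₀ : ℕ) (mus : List ℤ) : List ((ℤ × ℤ × ℤ × ℤ × ℤ) × ℤ) :=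
  ((gridPts m w₀).zip mus).filter fun q => q.2 ≠ 0

end Summit.Ventures.QEC.Census
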